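import Literature.Computability.QuantumComplexity.Forrelation
import Literature.Computability.Complexity.CodeFPStrings
import Literature.Computability.Complexity.CodeFPLists
import Literature.Computability.Complexity.FPStringBricks
import HarnessLib

/-!
# The circuit encoding of explicit Forrelation instances: plain mirror, evaluator, polynomial time

Topic `Literature/Computability/QuantumComplexity` (machine-side toolkit for the white-box
`k`-fold Forrelation problems of `Forrelation.lean` / `CubicForrelation.lean`; written for the
classical dequantizer of cubic 2-fold Forrelation, route `QuantumAdvantage/CubicForrelation`).

`Forrelation.lean` encodes an instance `I = (n, k, C₀, …, C_{k-1})` as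
`⟨bin n, ⟨bin k, [code C₀, …]⟩⟩`, a circuit as `⟨[gate codes], output wire⟩`, a gate as
`⟨truth table, [wire codes]⟩` and a wire as `0·bin i` (input `i`) / `1·bin m` (gate `m`)
(`KForrelationInstance.encode`, `encodeCircuit`, `encodeGate`, `encodeWire`). A polynomial-time
machine READING such codes is most easily certified in the typed algebra `CodeFP` (`CodeFP.lean`)
once the dependent types `Gate (Fin n)`, `Circuit (Fin n)` are replaced by PLAIN MIRROR TYPES whose
codes are literally the same strings:

* `Wire = Bool × ℕ` (`wireE`), `PGate = List Bool × List Wire` (`pgE`), `PCirc = List PGate × Wire`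
  (`pcE`), `Inst = ℕ × ℕ × List PCirc` (`instE`); the mirrors `wireOf`, `pgateOf`, `pcircOf`,
  `instOf` with **`encodeWire n w = wireE (wireOf w)`**, **`encodeGate g = pgE (pgateOf g)`**,
  **`encodeCircuit C = pcE (pcircOf C)`**, **`I.encode = instE (instOf I)`** (so
  `CodeFP KForrelationInstance.encode instE instOf` holds transparently, `instOf_codeFP`);
* the **evaluator** on the mirror: `wireVal`, `gateVal` (truth-table lookup at the little-endian
  index of the argument bits), `valsOf` (the straight-line fold of `Circuit.wireVals`), `evalP`;
  **correctness** `valsOf_pcircOf`, `evalP_pcircOf : evalP (pcircOf C) xs = C.eval x` whenever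
  `xs` lists `x` (`xs.getD i false = x i`);
* **polynomial time**: `wireVal_codeFP`, `gateVal_codeFP`, `valsOf_codeFP`, `evalP_codeFP`
  (`(circuit, input bits) ↦ [value]`), and the instance projections `instN_codeFP`, `instK_codeFP`,
  `instCircs_codeFP`.

Compare `CircuitEval.lean` (Arora–Barak Thm 6.18), which evaluates circuits in a DIFFERENT,
purpose-built description format (`CircEval.desc`) by a stack program; here the format is the one
fixed by the Forrelation problems and the proof is combinator-level.

## References

* S. Arora, B. Barak, *Computational Complexity: A Modern Approach*, CUP 2009, §6.1 (descriptions
  of circuits), Rem. 6.4 (straight-line programs), §1.3 (polynomial time, closure under bounded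
  loops). [AroraBarak2009]
* S. Aaronson, A. Ambainis, *Forrelation*, SIAM J. Comput. 47 (2018), §6 (explicit instances).
  [AaronsonAmbainis2018]
-/

namespace Literature.Computability.QuantumComplexity

namespace ForrCode

open _root_.Computability Literature.Computability.Complexity Literature.Computability.Complexity.CodeFP
open Literature.Computability.MetaComplexity (truthTable boolFunEquivFin)

variable {n : ℕ}

/-! ### Plain mirror types and their codes -/

/-- A wire: `(false, i)` = input `i`, `(true, m)` = gate `m`. [cite: AroraBarak2009, §6.1] -/
abbrev Wire : Type := Bool × ℕ

/-- The code of a wire: tag bit, then the binary index (this is `encodeWire`). [cite: AroraBarak2009, §6.1] -/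
def wireE : Wire → List Bool := fun w => w.1 :: natE w.2

/-- The mirror of a wire of a circuit on `n` inputs. [folklore] -/
def wireOf : Fin n ⊕ ℕ → Wire
  | .inl i => (false, (i : ℕ))
  | .inr m => (true, m)

/-- `encodeWire` factors through the mirror. [cite: AroraBarak2009, §6.1] -/
theorem encodeWire_eq (w : Fin n ⊕ ℕ) : encodeWire n w = wireE (wireOf w) := by
  cases w <;> rfl

/-- `wireE` is injective. [folklore] -/
theorem wireE_injective : Function.Injective wireE := by
  rintro ⟨a, i⟩ ⟨b, j⟩ h
  simp only [wireE, List.cons.injEq] at h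
  rw [h.1, natE_injective h.2]

/-- A gate: its truth table and its argument wires. [cite: AroraBarak2009, §6.1] -/
abbrev PGate : Type := List Bool × List Wire

/-- The code of a gate: `⟨truth table, [wire codes]⟩` (this is `encodeGate`). [cite: AroraBarak2009, §6.1] -/
abbrev pgE : PGate → List Bool := pairE strE (rawE wireE)

/-- The mirror of a gate. [folklore] -/
def pgateOf (g : Gate (Fin n)) : PGate := (truthTable g.op, List.ofFn fun a => wireOf (g.args a))

/-- `encodeCodeList` is the raw list code. [folklore] -/
theorem encodeCodeList_eq_rawE (l : List (List Bool)) : encodeCodeList l = rawE strE l := by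
  induction l with
  | nil => rfl
  | cons a l ih =>
    rw [rawE_cons, ← ih]; rfl

/-- `encodeGate` factors through the mirror. [cite: AroraBarak2009, §6.1] -/
theorem encodeGate_eq (g : Gate (Fin n)) : encodeGate g = pgE (pgateOf g) := by
  rw [encodeGate, encodeCodeList_eq_rawE, pgE, pairE_apply, pgateOf]
  simp only [rawE, List.map_ofFn]
  exact congrArg _ (congrArg _ (congrArg List.ofFn (funext fun a => encodeWire_eq _)))

/-- A circuit: its gates and its output wire. [cite: AroraBarak2009, §6.1] -/
abbrev PCirc : Type := List PGate × Wire

/-- The code of a circuit (this is `encodeCircuit`). [cite: AroraBarak2009, §6.1] -/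
abbrev pcE : PCirc → List Bool := pairE (rawE pgE) wireE

/-- The mirror of a circuit. [folklore] -/
def pcircOf (C : Circuit (Fin n)) : PCirc := (C.gates.map pgateOf, wireOf C.output)

/-- `encodeCircuit` factors through the mirror. [cite: AroraBarak2009, §6.1] -/
theorem encodeCircuit_eq (C : Circuit (Fin n)) : encodeCircuit C = pcE (pcircOf C) := by
  rw [encodeCircuit, encodeCodeList_eq_rawE, pcE, pairE_apply, pcircOf]
  simp only [rawE, List.map_map]
  rw [List.map_congr_left (fun g _ => show (strE ∘ encodeGate) g = (pgE ∘ pgateOf) g from encodeGate_eq g),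
    encodeWire_eq]

/-- An instance: `(n, k, circuits)`. [cite: AaronsonAmbainis2018, §6] -/
abbrev Inst : Type := ℕ × ℕ × List PCirc

/-- The code of an instance (this is `KForrelationInstance.encode`). [cite: AaronsonAmbainis2018, §6] -/
abbrev instE : Inst → List Bool := pairE natE (pairE natE (rawE pcE))

/-- The mirror of an instance. [folklore] -/
def instOf (I : KForrelationInstance) : Inst := (I.n, I.k, List.ofFn fun i => pcircOf (I.C i))

/-- **The Forrelation instance code factors through the mirror.** [cite: AaronsonAmbainis2018, §6] -/
theorem encode_eq (I : KForrelationInstance) : I.encode = instE (instOf I) := by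
  rw [KForrelationInstance.encode, encodeCodeList_eq_rawE, instE, pairE_apply, pairE_apply, instOf]
  simp only [rawE, List.map_ofFn]
  congr 4
  funext i
  exact encodeCircuit_eq _

/-- Hence the mirror map is computed transparently on codes. [folklore] -/
theorem instOf_codeFP : CodeFP KForrelationInstance.encode instE instOf :=
  transparent fun I => (encode_eq I).symm

/-- The circuits of the mirror instance. [folklore] -/
theorem instOf_circs (I : KForrelationInstance) : (instOf I).2.2 = List.ofFn fun i => pcircOf (I.C i) := rfl

/-! ### The evaluator on the mirror -/

/-- The value of a wire, given the input bits `x` and the gate values `vals` computed so far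
(out-of-range references read `false`, as in `Circuit.wireVals`). [cite: AroraBarak2009, Rem. 6.4] -/
def wireVal (x vals : List Bool) (w : Wire) : Bool := if w.1 then vals.getD w.2 false else x.getD w.2 false

/-- The value of a gate: its truth table at the little-endian index of the argument bits.
[cite: AroraBarak2009, Rem. 6.4] -/
def gateVal (x vals : List Bool) (g : PGate) : Bool := g.1.getD (bitsToNat (g.2.map (wireVal x vals))) false

/-- The values of all gates, in program order (the fold of `Circuit.wireVals`). [cite: AroraBarak2009, Rem. 6.4] -/
def valsOf (gs : List PGate) (x : List Bool) : List Bool := gs.foldl (fun vals g => vals ++ [gateVal x vals g]) []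

/-- **The value of a circuit** on input bits `x`. [cite: AroraBarak2009, Def. 6.1] -/
def evalP (c : PCirc) (x : List Bool) : Bool := wireVal x (valsOf c.1 x) c.2

/-! ### Correctness against `Circuit.eval` -/

/-- The little-endian value of a listed bit vector is its index in the enumeration
`boolFunEquivFin` of the cube. [folklore] -/
theorem bitsToNat_ofFn_eq : ∀ {L : ℕ} (v : Fin L → Bool), bitsToNat (List.ofFn v) = ((boolFunEquivFin L v : Fin (2 ^ L)) : ℕ)
  | 0, v => by simp [boolFunEquivFin]
  | L + 1, v => by
    rw [List.ofFn_succ, bitsToNat_cons, bitsToNat_ofFn_eq]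
    change (v 0).toNat + 2 * ((finFunctionFinEquiv fun i : Fin L => finTwoEquiv.symm (v i.succ)) : ℕ) =
      ((finFunctionFinEquiv fun i : Fin (L + 1) => finTwoEquiv.symm (v i)) : ℕ)
    rw [finFunctionFinEquiv_apply, finFunctionFinEquiv_apply, Fin.sum_univ_succ]
    simp only [Fin.val_zero, pow_zero, mul_one, Fin.val_succ, pow_succ]
    rw [Finset.mul_sum]
    congr 1
    · cases v 0 <;> rfl
    · exact Finset.sum_congr rfl fun i _ => by ring

/-- **Truth-table lookup**: the entry of `truthTable f` at the little-endian index of `v` is `f v`.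
[folklore] -/
theorem getD_truthTable (f : (Fin n → Bool) → Bool) (v : Fin n → Bool) :
    (truthTable f).getD (bitsToNat (List.ofFn v)) false = f v := by
  rw [bitsToNat_ofFn_eq, truthTable, List.getD_eq_getElem _ _ (by simp), List.getElem_ofFn]
  simp

/-- The mirror gate evaluates like the gate. [cite: AroraBarak2009, Rem. 6.4] -/
theorem gateVal_pgateOf (g : Gate (Fin n)) (x : Fin n → Bool) (xs : List Bool) (hx : ∀ i : Fin n, xs.getD i false = x i)
    (vals : List Bool) :
    gateVal xs vals (pgateOf g) = g.op fun a => match g.args a with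
      | .inl i => x i
      | .inr m => vals.getD m false := by
  rw [gateVal, pgateOf]
  simp only [List.map_ofFn]
  rw [← getD_truthTable g.op]
  congr 3
  funext a
  simp only [Function.comp_apply]
  cases g.args a with
  | inl i => simp only [wireOf, wireVal, Bool.false_eq_true, if_false]; exact hx i
  | inr m => simp [wireOf, wireVal]

/-- **The mirror computes the gate values of the circuit.** [cite: AroraBarak2009, Rem. 6.4] -/
theorem valsOf_pcircOf (C : Circuit (Fin n)) (x : Fin n → Bool) (xs : List Bool) (hx : ∀ i : Fin n, xs.getD i false = x i) :
    valsOf (pcircOf C).1 xs = C.wireVals x := by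
  rw [valsOf, pcircOf, Circuit.wireVals, List.foldl_map]
  congr 1
  funext vals g
  rw [gateVal_pgateOf g x xs hx]
  congr 2
  exact congrArg g.op (funext fun a => by cases g.args a <;> rfl)

/-- **The mirror computes the value of the circuit.** [cite: AroraBarak2009, Def. 6.1] -/
theorem evalP_pcircOf (C : Circuit (Fin n)) (x : Fin n → Bool) (xs : List Bool) (hx : ∀ i : Fin n, xs.getD i false = x i) :
    evalP (pcircOf C) xs = C.eval x := by
  rw [evalP, valsOf_pcircOf C x xs hx, Circuit.eval]
  show wireVal xs (C.wireVals x) (wireOf C.output) = _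
  cases C.output with
  | inl i => simp only [wireOf, wireVal, Bool.false_eq_true, if_false]; exact hx i
  | inr m => simp [wireOf, wireVal]

/-- The listed input `List.ofFn x` lists `x`. [folklore] -/
theorem getD_ofFn (x : Fin n → Bool) (i : Fin n) : (List.ofFn x).getD i false = x i := by
  rw [List.getD_eq_getElem _ _ (by simp), List.getElem_ofFn]

/-- In particular on the listed input. [cite: AroraBarak2009, Def. 6.1] -/
theorem evalP_pcircOf_ofFn (C : Circuit (Fin n)) (x : Fin n → Bool) : evalP (pcircOf C) (List.ofFn x) = C.eval x :=
  evalP_pcircOf C x _ (getD_ofFn x)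

/-- Reading a bit list of any length as an input of `n` bits. [folklore] -/
def toInput (n : ℕ) (xs : List Bool) : Fin n → Bool := fun i => xs.getD i false

/-- The mirror value on any bit list is the circuit value on its reading. [cite: AroraBarak2009, Def. 6.1] -/
theorem evalP_pcircOf_eq (C : Circuit (Fin n)) (xs : List Bool) : evalP (pcircOf C) xs = C.eval (toInput n xs) :=
  evalP_pcircOf C _ xs fun _ => rfl

/-! ### Polynomial time -/

/-- The tag of a wire. [folklore] -/
theorem wireTag_codeFP : CodeFP wireE bitE Prod.fst := of_fn take1Fn take1Fn_mem_FP fun _ => rfl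

/-- The index of a wire. [folklore] -/
theorem wireIdx_codeFP : CodeFP wireE natE Prod.snd := of_fn List.tail PRelSigma.tail_mem_FP fun _ => rfl

/-- **Wire values on codes**: `((x, vals), w) ↦ wireVal x vals w`. [cite: AroraBarak2009, §1.3] -/
theorem wireVal_codeFP : CodeFP (pairE (pairE strE strE) wireE) bitE (fun t => wireVal t.1.1 t.1.2 t.2) := by
  have hi : CodeFP (pairE (pairE strE strE) wireE) natE (fun t => t.2.2) := wireIdx_codeFP.comp (snd _ _)
  exact ((wireTag_codeFP.comp (snd _ _)).ite (strGetDNat.comp ((fst _ _).snd'.pair hi))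
    (strGetDNat.comp ((fst _ _).fst'.pair hi))).congr fun _ => rfl

/-- A bit as a one-symbol string. [folklore] -/
theorem bitStr_codeFP : CodeFP bitE strE (fun b => [b]) := transparent fun _ => rfl

/-- **Gate values on codes**: `((x, vals), g) ↦ gateVal x vals g`. [cite: AroraBarak2009, §1.3] -/
theorem gateVal_codeFP : CodeFP (pairE (pairE strE strE) pgE) bitE (fun t => gateVal t.1.1 t.1.2 t.2) := by
  have hm := CodeFP.map (σ := List Bool × List Bool) (eσ := pairE strE strE) (eα := wireE) (eβ := bitE)
    (g := fun t => wireVal t.1.1 t.1.2 t.2) wireVal_codeFP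
  have hbits : CodeFP (pairE (pairE strE strE) pgE) (rawE bitE) (fun t => t.2.2.map (wireVal t.1.1 t.1.2)) :=
    (hm.comp ((fst _ _).pair (snd _ _).snd')).congr fun _ => rfl
  exact (strGetDNat.comp ((snd _ _).fst'.pair (strVal.comp (bitsToStr.comp hbits)))).congr fun _ => rfl

/-- **All gate values on codes**: `(x, gates) ↦ valsOf gates x` (the accumulator has one bit per
gate, so the fold is polynomially bounded). [cite: AroraBarak2009, §1.3 (bounded loops)] -/
theorem valsOf_codeFP : CodeFP (pairE strE (rawE pgE)) strE (fun p => valsOf p.2 p.1) := by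
  have hstep : CodeFP (pairE strE (pairE pgE strE)) strE (fun t => t.2.2 ++ [gateVal t.1 t.2.2 t.2.1]) :=
    strAppend.comp ((snd _ _).snd'.pair (bitStr_codeFP.comp (gateVal_codeFP.comp (((fst _ _).pair (snd _ _).snd').pair (snd _ _).fst'))))
  refine (CodeFP.foldl (σ := List Bool) (α := PGate) (β := List Bool) (eσ := strE) (eα := pgE) (eβ := strE)
    (step := fun x g vals => vals ++ [gateVal x vals g]) (init := fun _ => []) hstep (const _ []) Polynomial.X
    fun x l₁ l₂ => ?_).congr fun _ => rfl
  have hlen : ∀ (l : List PGate) (acc : List Bool), (l.foldl (fun vals g => vals ++ [gateVal x vals g]) acc).length = acc.length + l.length := by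
    intro l
    induction l with
    | nil => intro acc; simp
    | cons g l ih => intro acc; rw [List.foldl_cons, ih]; simp; omega
  rw [Polynomial.eval_X, pairE_apply, length_boolPair]
  have h1 := hlen l₁ []
  have h2 : l₁.length ≤ (rawE pgE (l₁ ++ l₂)).length := le_trans (by simp) (length_le_length_rawE _ _)
  simp only [strE, id, List.length_nil, zero_add] at h1 ⊢
  omega

/-- **Circuit values on codes**: `(c, x) ↦ [evalP c x]`. [cite: AroraBarak2009, §1.3] -/
theorem evalP_codeFP : CodeFP (pairE pcE strE) bitE (fun p => evalP p.1 p.2) := by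
  have hv : CodeFP (pairE pcE strE) strE (fun p => valsOf p.1.1 p.2) := valsOf_codeFP.comp ((snd _ _).pair (fst _ _).fst')
  exact (wireVal_codeFP.comp (((snd _ _).pair hv).pair (fst _ _).snd')).congr fun _ => rfl

/-- The arity field `n` of an instance. [folklore] -/
theorem instN_codeFP : CodeFP instE natE (fun t => t.1) := fst _ _

/-- The field `k` of an instance. [folklore] -/
theorem instK_codeFP : CodeFP instE natE (fun t => t.2.1) := (snd _ _).fst'

/-- The circuit list of an instance. [folklore] -/
theorem instCircs_codeFP : CodeFP instE (rawE pcE) (fun t => t.2.2) := (snd _ _).snd'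

/-- The default (empty) circuit used for out-of-range indices. [folklore] -/
def nilCirc : PCirc := ([], (false, 0))

/-- The `i`-th circuit of an instance (the empty circuit out of range). [folklore] -/
def circAt (t : Inst) (i : ℕ) : PCirc := t.2.2.getD i nilCirc

/-- `circAt` on codes. [cite: AroraBarak2009, §1.3] -/
theorem circAt_codeFP : CodeFP (pairE instE natE) pcE (fun p => circAt p.1 p.2) :=
  ((rawGetOr pcE).comp ((instCircs_codeFP.comp (fst _ _)).pair ((snd _ _).pair (const _ nilCirc)))).congr fun _ => rfl

/-- The circuits of a genuine instance. [folklore] -/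
theorem circAt_instOf (I : KForrelationInstance) (i : Fin I.k) : circAt (instOf I) i = pcircOf (I.C i) := by
  rw [circAt, instOf_circs, List.getD_eq_getElem _ _ (by simp), List.getElem_ofFn]

end ForrCode

end Literature.Computability.QuantumComplexity
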